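import Summits.ResolutionOfSingularities.ResolutionOfSingularities.Theorems.EquisingularLiftEquisingularLiftNatCentreTwoFrame
import Literature.AlgebraicGeometry.Resolution.RegularCentreLocal
import Literature.AlgebraicGeometry.HodgeTheory.BlochSemiregularSpread
import HarnessLib

/-!
# [OURS · L1 W4.5(b) · EL♮(3)] T-CENTRE-2FRAME (ii) — a regular codimension-2 centre of a regular locally Noetherian scheme is a
# regular immersion of codimension 2 (`IsRegularImmersionOfCodim 𝒞.subschemeι 2`)
# (crux `EquisingularLiftNatThree` stmt-ResolutionOfSingularities-20148 / parent 20038; S1/S2 input (c)(ii), route C `hri`)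

NOT a statement of any manuscript. Helper file of the chain res-L1-w45b (cell `res-hironaka`, LADDER-RESOLUTION rung L, slot W4.5(b));
OURS; AI-written, weaker than expert review; `--supports stmt-ResolutionOfSingularities-20148 --as helper` by res-D-brk-4 g9 on
res-L1-w45b-plan-1's NAMING 2026-08-27T20:04:04Z (signature of record = res-L1-w45b-stub-3 HANDOFF §gen 6 / STATUS 20:01:42Z).
No `sorry`; standard axioms; no definitions.

WHAT. `isRegularImmersionOfCodim_two_of_twoFrames`: for `X` integral, locally Noetherian and regular, and an ideal sheaf `𝒞` with
`V(𝒞)` regular and `dim (𝒪_{X,x} ⧸ 𝒞_x) + 2 = dim 𝒪_{X,x}` at the points of `supp 𝒞`, the closed immersion `V(𝒞) ↪ X` is a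
REGULAR IMMERSION OF CODIMENSION 2 in the sense of the tree's real predicate `Literature.AlgebraicGeometry.HodgeTheory.IsRegularImmersionOfCodim`
(`BlochSemiregularSpread.lean`: near every point an affine open `U` and a weakly regular sequence of length `2` in `Γ(X, U)` generating
`𝓘(U)`). CONSUMERS: res-D-pv-051's `hri : IsRegularImmersionOfCodim I.subschemeι 2` (TARGET-DIRLIFT-UP, route C entry theorem) and
res-L1-w45b-stub-2's input (c) in chart form.

PROOF (spreading out, [Liu2002, Thm. 8.1.19 (a)] / [Matsumura1987, Thms. 14.2, 16.2]; the tree's `RegularCentreLocal.lean` route at the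
stalk instead of at a regular RING). Fix `z`, `x = ι z ∈ supp 𝒞`, an affine open `V ∋ x`, `A = Γ(X, V)` (Noetherian), `𝔭 = 𝔭_x`,
`I = 𝒞(V)`, `R = 𝒪_{X,x} = A_𝔭` (regular local), `J = 𝒞_x = I R` with `R ⧸ J ≅ 𝒪_{V(𝒞),z}` regular. (1) `J` is generated by images
`f′ᵢ = fᵢ/1`, `fᵢ ∈ I`, with linearly independent differentials (`exists_span_eq_of_isRegularLocalRing_quotient`), exactly `2` of them
by the dimension count (`RegularParameters.isRegularLocalRing_quotient_span_range`, as in T-CENTRE-2FRAME (i) p564791), and such a family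
is an `R`-sequence in colon form (`mem_span_image_of_mul_mem_of_linearIndependent_toCotangent`). (2) Uniform denominators
(`exists_uniform_multiplier_of_regular_at_prime`) and clearing the denominators of the finitely many generators of `I` give `g ∉ 𝔭`
with `I · A[1/g] = (f₀, f₁)` and `f₀, f₁` an `A[1/g]`-sequence in colon form (`regularSeq_map_of_uniform_multiplier`). (3) On the affine
open `U = D(g) ⊆ V`, `Γ(X, U) = A[1/g]` (`IsAffineOpen.isLocalization_basicOpen`), `𝓘(U) = I · Γ(X, U)` (`IdealSheafData.map_ideal_basicOpen`,
`ker_subschemeι`), and the colon form is Mathlib's `RingTheory.Sequence.IsWeaklyRegular Γ(X, U) [f₀, f₁]` (`isWeaklyRegular_cons_iff`).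

References: Q. Liu, *Algebraic Geometry and Arithmetic Curves* (2002), Thm. 8.1.19 (a), §6.3.2 [cite: Liu2002]; H. Matsumura,
*Commutative Ring Theory* (1986), Thms. 14.2, 16.2 [cite: Matsumura1987]; U. Görtz, T. Wedhorn, *Algebraic Geometry II*, Def. 19.19 /
19.23 [cite: GortzWedhorn2023]; tree `…Resolution.RegularCentreLocal`, `…RegularQuotientIdeal`, `…NatCentreTwoFrame` (p564791).
-/

set_option linter.dupNamespace false -- mandated namespace `Summit.<Summit>.<Problem>` of this single-conjunct summit

noncomputable section

open CategoryTheory AlgebraicGeometry IsLocalRing TopologicalSpace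
open Literature.AlgebraicGeometry.Resolution
open Literature.AlgebraicGeometry.HodgeTheory
open AlgebraicGeometry.Scheme.IdealSheafData
open RingTheory.Sequence
open scoped Pointwise

namespace Summit.ResolutionOfSingularities.ResolutionOfSingularities.Cruxes.EquisingularLiftNat.Sections

universe u

/-! ## A colon-form regular pair is weakly regular (Mathlib's `IsWeaklyRegular`) -/

/-- A pair `F₀, F₁` of a commutative ring `L` in COLON FORM — `F₀` a non-zero-divisor and `F₁ y ∈ (F₀) → y ∈ (F₀)` — is a weakly
regular sequence `[F₀, F₁]` on `L` in Mathlib's sense. [folklore] -/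
theorem isWeaklyRegular_pair_of_colon {L : Type u} [CommRing L] (F₀ F₁ : L)
    (h₀ : ∀ y : L, F₀ * y = 0 → y = 0) (h₁ : ∀ y : L, F₁ * y ∈ Ideal.span {F₀} → y ∈ Ideal.span {F₀}) :
    IsWeaklyRegular L [F₀, F₁] := by
  rw [isWeaklyRegular_cons_iff, isWeaklyRegular_cons_iff]
  refine ⟨?_, ?_, IsWeaklyRegular.nil _ _⟩
  · intro a b hab
    have h : F₀ * a = F₀ * b := hab
    have : a - b = 0 := h₀ _ (by rw [mul_sub, h, sub_self])
    exact sub_eq_zero.mp this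
  · intro a b hab
    induction a using Submodule.Quotient.induction_on with
    | _ a =>
    induction b using Submodule.Quotient.induction_on with
    | _ b =>
    have hmem : ∀ y : L, y ∈ F₀ • (⊤ : Submodule L L) ↔ y ∈ Ideal.span {F₀} := fun y => by
      rw [Submodule.mem_smul_pointwise_iff_exists, Ideal.mem_span_singleton']
      constructor
      · rintro ⟨b, -, rfl⟩
        exact ⟨b, by rw [smul_eq_mul, mul_comm]⟩
      · rintro ⟨a, rfl⟩
        exact ⟨a, Submodule.mem_top, by rw [smul_eq_mul, mul_comm]⟩
    have hab' : (Submodule.Quotient.mk (F₁ • a) : QuotSMulTop F₀ L) = Submodule.Quotient.mk (F₁ • b) := by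
      rw [Submodule.Quotient.mk_smul, Submodule.Quotient.mk_smul]
      exact hab
    rw [Submodule.Quotient.eq, hmem] at hab'
    rw [Submodule.Quotient.eq, hmem]
    refine h₁ _ ?_
    rw [mul_sub]
    exact hab'

/-! ## T-CENTRE-2FRAME (ii) -/

/-- **T-CENTRE-2FRAME (ii) — a regular codimension-`2` centre is a regular immersion of codimension `2`.** For `X` integral, locally
Noetherian and regular, and an ideal sheaf `𝒞` with `V(𝒞)` regular and `dim (𝒪_{X,x} ⧸ 𝒞_x) + 2 = dim 𝒪_{X,x}` on `supp 𝒞`: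
`IsRegularImmersionOfCodim 𝒞.subschemeι 2` — near every point an affine open `U = D(g)` and a weakly regular pair `f₀, f₁ ∈ Γ(X, U)`
generating `𝒞(U)` (spread out from a regular pair of generators of the stalk `𝒞_x ⊂ 𝒪_{X,x}`). Signature of record: res-L1-w45b-stub-3
HANDOFF §gen 6. [cite: Liu2002, Thm. 8.1.19 (a)] [cite: Matsumura1987, Thm. 14.2, Thm. 16.2] [cite: GortzWedhorn2023, Def. 19.19]
[OURS · L1 W4.5b] T-CENTRE-2FRAME (ii); NOT a statement of the manuscript. -/
theorem isRegularImmersionOfCodim_two_of_twoFrames {X : Scheme.{u}} [IsIntegral X] [IsLocallyNoetherian X]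
    (𝒞 : X.IdealSheafData) (hX : Scheme.IsRegular X) (h𝒞 : Scheme.IsRegular 𝒞.subscheme)
    (hcodim : ∀ x ∈ 𝒞.support, ringKrullDim (X.presheaf.stalk x ⧸ stalkIdeal 𝒞 x) + 2 = ringKrullDim (X.presheaf.stalk x)) :
    IsRegularImmersionOfCodim 𝒞.subschemeι 2 := by
  classical
  refine ⟨inferInstance, fun z => ?_⟩
  -- the point `x = ι z ∈ supp 𝒞`, an affine open `V ∋ x`, `A = Γ(X, V)`, the prime `𝔭` of `x`, `I = 𝒞(V)`
  set x : X := 𝒞.subschemeι.base z with hxdef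
  have hxsupp : x ∈ 𝒞.support := by
    have h : x ∈ (𝒞.support : Set X) := by
      rw [← Scheme.IdealSheafData.range_subschemeι]; exact ⟨z, rfl⟩
    exact h
  obtain ⟨V', hV', hxV, -⟩ :=
    exists_isAffineOpen_mem_and_subset (X := X) (x := x) (U := ⊤) (Opens.mem_top x)
  let V : X.affineOpens := ⟨V', hV'⟩
  have hV : IsAffineOpen (V : X.Opens) := hV'
  haveI : IsNoetherianRing Γ(X, V) := IsLocallyNoetherian.component_noetherian V
  letI algR : Algebra Γ(X, V) (X.presheaf.stalk x) := TopCat.Presheaf.algebra_section_stalk X.presheaf ⟨x, hxV⟩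
  set 𝔭 : Ideal Γ(X, V) := (hV.primeIdealOf ⟨x, hxV⟩).asIdeal with h𝔭def
  haveI h𝔭p : 𝔭.IsPrime := (hV.primeIdealOf ⟨x, hxV⟩).isPrime
  haveI hloc : IsLocalization.AtPrime (X.presheaf.stalk x) 𝔭 := hV.isLocalization_stalk ⟨x, hxV⟩
  set I : Ideal Γ(X, V) := 𝒞.ideal V with hIdef
  -- the regular local ring `R = 𝒪_{X,x}` and `J = 𝒞_x = I R` with regular quotient
  haveI : IsRegularLocalRing (X.presheaf.stalk x) := hX x
  have hJ : stalkIdeal 𝒞 x = I.map (algebraMap Γ(X, V) (X.presheaf.stalk x)) := by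
    rw [stalkIdeal_eq_map_germ 𝒞 V hxV]
    rfl
  have hJm : stalkIdeal 𝒞 x ≤ maximalIdeal _ := (mem_support_iff_stalkIdeal_le 𝒞 x).mp hxsupp
  have hsurj : Function.Surjective (𝒞.subschemeι.stalkMap z).hom := 𝒞.subschemeι.stalkMap_surjective z
  have hker : RingHom.ker (𝒞.subschemeι.stalkMap z).hom = stalkIdeal 𝒞 x := by
    rw [← stalkIdeal_ker_eq_ker_stalkMap, Scheme.IdealSheafData.ker_subschemeι]
  haveI := h𝒞 z
  haveI hq : IsRegularLocalRing (X.presheaf.stalk x ⧸ stalkIdeal 𝒞 x) :=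
    IsRegularLocalRing.of_ringEquiv
      (((RingHom.quotientKerEquivOfSurjective hsurj).symm).trans (Ideal.quotEquivOfEq hker))
  -- (1) generators `f′ᵢ = fᵢ/1`, `fᵢ ∈ I`, with independent differentials; exactly two of them
  have hG : Ideal.span (algebraMap Γ(X, V) (X.presheaf.stalk x) '' (I : Set Γ(X, V))) = stalkIdeal 𝒞 x := by
    rw [hJ]; rfl
  obtain ⟨c, f', hf'G, hspan', hli⟩ := exists_span_eq_of_isRegularLocalRing_quotient hJm _ hG
  have hf'𝔪 : ∀ i, f' i ∈ maximalIdeal _ := fun i => hJm (hspan' ▸ Ideal.subset_span ⟨i, rfl⟩)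
  have hc : c = 2 := by
    have hdim := (RegularParameters.isRegularLocalRing_quotient_span_range f' hf'𝔪
      (forall_mem_maximalIdeal_of_linearIndependent_toCotangent f' hf'𝔪 hli)).2
    rw [hspan'] at hdim
    obtain ⟨d, hd⟩ := exists_ringKrullDim_eq_natCast (X.presheaf.stalk x ⧸ stalkIdeal 𝒞 x)
    have h := hdim.trans (hcodim x hxsupp).symm
    rw [hd] at h
    have h' : ((d + c : ℕ) : WithBot ℕ∞) = ((d + 2 : ℕ) : WithBot ℕ∞) := by push_cast; exact h
    have h'' : d + c = d + 2 := by exact_mod_cast h'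
    omega
  subst hc
  -- preimages `fᵢ ∈ I`
  have hpre : ∀ i, ∃ a : Γ(X, V), a ∈ I ∧ algebraMap Γ(X, V) (X.presheaf.stalk x) a = f' i := fun i => by
    obtain ⟨a, ha, h⟩ := hf'G i
    exact ⟨a, ha, h⟩
  choose f hfI hff' using hpre
  have himg : ∀ T : Set (Fin 2), Ideal.span (f' '' T) =
      (Ideal.span (f '' T)).map (algebraMap Γ(X, V) (X.presheaf.stalk x)) := fun T => by
    rw [Ideal.map_span, Set.image_image]
    congr 1
    ext w
    simp only [Set.mem_image, hff']
  -- colon-form regularity at `𝔭`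
  have hreg : ∀ (i : Fin 2) (y : Γ(X, V)), f i * y ∈ Ideal.span (f '' Set.Iio i) →
      ∃ s : Γ(X, V), s ∉ 𝔭 ∧ s * y ∈ Ideal.span (f '' Set.Iio i) := by
    intro i y hy
    have h1 : f' i * algebraMap Γ(X, V) (X.presheaf.stalk x) y ∈ Ideal.span (f' '' Set.Iio i) := by
      rw [himg, ← hff', ← map_mul]
      exact Ideal.mem_map_of_mem _ hy
    have h2 := mem_span_image_of_mul_mem_of_linearIndependent_toCotangent f' hf'𝔪 hli i (Set.Iio i)
      (fun h => lt_irrefl i h) _ h1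
    rw [himg, IsLocalization.algebraMap_mem_map_algebraMap_iff 𝔭.primeCompl] at h2
    obtain ⟨s, hs, hsy⟩ := h2
    exact ⟨s, hs, hsy⟩
  obtain ⟨g₁, hg₁p, hg₁⟩ := exists_uniform_multiplier_of_regular_at_prime f 𝔭 hreg
  -- (2) the generators of `I` lie in `(f) A_𝔭`: clear denominators
  obtain ⟨gens, hgens⟩ := (IsNoetherian.noetherian I : I.FG)
  have hgen1 : ∀ w : Γ(X, V), w ∈ gens → ∃ t : Γ(X, V), t ∉ 𝔭 ∧ t * w ∈ Ideal.span (Set.range f) := by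
    intro w hw
    have hwI : w ∈ I := hgens ▸ Submodule.subset_span hw
    have h1 : algebraMap Γ(X, V) (X.presheaf.stalk x) w ∈ Ideal.span (Set.range f') := by
      rw [hspan', hJ]
      exact Ideal.mem_map_of_mem _ hwI
    have hrange : Set.range f' = Set.range (algebraMap Γ(X, V) (X.presheaf.stalk x) ∘ f) := by
      ext w'
      simp only [Set.mem_range, Function.comp_apply, hff']
    rw [hrange, Set.range_comp, ← Ideal.map_span,
      IsLocalization.algebraMap_mem_map_algebraMap_iff 𝔭.primeCompl] at h1
    obtain ⟨t, ht, htw⟩ := h1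
    exact ⟨t, ht, htw⟩
  choose! t ht using hgen1
  have hg₀p : (∏ w ∈ gens, t w) ∉ 𝔭 := by
    intro hmem
    obtain ⟨w, hw, htw⟩ := (h𝔭p.prod_mem_iff).mp hmem
    exact (ht w hw).1 htw
  set g : Γ(X, V) := (∏ w ∈ gens, t w) * g₁ with hgdef
  have hgp : g ∉ 𝔭 := fun h => (h𝔭p.mem_or_mem h).elim hg₀p hg₁p
  -- (3) the affine open `U = D(g) ∋ x`, `Γ(X, U) = A[1/g]`
  let U : X.affineOpens := X.affineBasicOpen g
  have hxU : x ∈ (U : X.Opens) := by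
    show x ∈ X.basicOpen g
    rw [X.mem_basicOpen g x hxV]
    exact (IsLocalization.AtPrime.isUnit_to_map_iff (X.presheaf.stalk x) 𝔭 g).mpr hgp
  haveI hLoc : IsLocalization.Away g Γ(X, X.basicOpen g) := hV.isLocalization_basicOpen g
  have hunit : ∀ w : Γ(X, V), w ∈ gens → IsUnit (algebraMap Γ(X, V) Γ(X, X.basicOpen g) (t w)) := by
    intro w hw
    have hu : IsUnit (algebraMap Γ(X, V) Γ(X, X.basicOpen g) g) := IsLocalization.Away.algebraMap_isUnit g
    have hdvd : t w ∣ g := (Finset.dvd_prod_of_mem t hw).mul_right g₁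
    exact isUnit_of_dvd_unit (map_dvd (algebraMap Γ(X, V) Γ(X, X.basicOpen g)) hdvd) hu
  -- `I · Γ(X, U) = (f₀, f₁)`
  have hIL : I.map (algebraMap Γ(X, V) Γ(X, X.basicOpen g)) =
      Ideal.span (Set.range (algebraMap Γ(X, V) Γ(X, X.basicOpen g) ∘ f)) := by
    apply le_antisymm
    · rw [← hgens, Ideal.map_span, Ideal.span_le]
      rintro _ ⟨w, hw, rfl⟩
      have hw' : w ∈ gens := hw
      have hmem : algebraMap Γ(X, V) Γ(X, X.basicOpen g) (t w * w) ∈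
          Ideal.span (Set.range (algebraMap Γ(X, V) Γ(X, X.basicOpen g) ∘ f)) := by
        rw [Set.range_comp, ← Ideal.map_span]
        exact Ideal.mem_map_of_mem _ (ht w hw').2
      rw [map_mul] at hmem
      exact (Ideal.unit_mul_mem_iff_mem _ (hunit w hw')).mp hmem
    · rw [Ideal.span_le]
      rintro _ ⟨i, rfl⟩
      exact Ideal.mem_map_of_mem _ (hfI i)
  -- colon form on `Γ(X, U)`
  have hgmul : ∀ (i : Fin 2) (y : Γ(X, V)), f i * y ∈ Ideal.span (f '' Set.Iio i) →
      g * y ∈ Ideal.span (f '' Set.Iio i) := fun i y hy => by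
    rw [hgdef, mul_assoc]
    exact Ideal.mul_mem_left _ _ (hg₁ i y hy)
  set F₀ : Γ(X, X.basicOpen g) := algebraMap Γ(X, V) Γ(X, X.basicOpen g) (f 0) with hF₀
  set F₁ : Γ(X, X.basicOpen g) := algebraMap Γ(X, V) Γ(X, X.basicOpen g) (f 1) with hF₁
  have hIio0 : (algebraMap Γ(X, V) Γ(X, X.basicOpen g) ∘ f) '' Set.Iio (0 : Fin 2) = ∅ := by
    rw [Set.image_eq_empty]
    ext j
    simp only [Set.mem_Iio, Set.mem_empty_iff_false, iff_false]
    exact fun hj => (Nat.not_lt_zero _) (Fin.lt_def.mp hj)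
  have hIio1 : (algebraMap Γ(X, V) Γ(X, X.basicOpen g) ∘ f) '' Set.Iio (1 : Fin 2) = {F₀} := by
    ext w
    simp only [Set.mem_image, Set.mem_Iio, Set.mem_singleton_iff, Function.comp_apply]
    constructor
    · rintro ⟨j, hj, rfl⟩
      fin_cases j
      · rfl
      · exact absurd (Fin.lt_def.mp hj) (lt_irrefl _)
    · rintro rfl
      exact ⟨0, Fin.zero_lt_one, rfl⟩
  have h₀ : ∀ y : Γ(X, X.basicOpen g), F₀ * y = 0 → y = 0 := by
    intro y hy
    have h := regularSeq_map_of_uniform_multiplier f hgmul Γ(X, X.basicOpen g) 0 y (by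
      rw [hIio0, Ideal.span_empty]
      change F₀ * y ∈ (⊥ : Ideal Γ(X, X.basicOpen g))
      rw [hy]
      exact Submodule.zero_mem _)
    rwa [hIio0, Ideal.span_empty, Ideal.mem_bot] at h
  have h₁ : ∀ y : Γ(X, X.basicOpen g), F₁ * y ∈ Ideal.span {F₀} → y ∈ Ideal.span {F₀} := by
    intro y hy
    have h := regularSeq_map_of_uniform_multiplier f hgmul Γ(X, X.basicOpen g) 1 y (by
      rw [hIio1]
      change F₁ * y ∈ Ideal.span {F₀}
      exact hy)
    rwa [hIio1] at h
  refine ⟨U, hxU, [F₀, F₁], rfl, isWeaklyRegular_pair_of_colon F₀ F₁ h₀ h₁, ?_⟩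
  -- `(F₀, F₁) = 𝓘(U)`
  have hker' : 𝒞.subschemeι.ker.ideal U = I.map (algebraMap Γ(X, V) Γ(X, X.basicOpen g)) := by
    rw [Scheme.IdealSheafData.ker_subschemeι]
    exact (𝒞.map_ideal_basicOpen V g).symm
  rw [hker', hIL]
  unfold Ideal.ofList
  congr 1
  ext w
  simp only [Set.mem_setOf_eq, List.mem_cons, List.not_mem_nil, or_false]
  constructor
  · rintro (rfl | rfl)
    · exact ⟨0, rfl⟩
    · exact ⟨1, rfl⟩
  · rintro ⟨j, rfl⟩
    fin_cases j
    · exact Or.inl rfl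
    · exact Or.inr rfl

end Summit.ResolutionOfSingularities.ResolutionOfSingularities.Cruxes.EquisingularLiftNat.Sections

end
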